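import Mathlib
import Summits.QuantumFields.YangMills.Theorems.SpecificationCompactnessFibreRatioKernel
import Literature.MathematicalPhysics.QuantumFieldTheory.Balaban1983to89.T3UnitLawDensityEML
import Literature.MathematicalPhysics.QuantumFieldTheory.Balaban1983to89.T3OrbitAverage
import HarnessLib

/-!
# Route `SpecificationCompactness` — THE FIBRE LIMIT in the route's vocabulary, for BOTH typings of the deciding crux:
# `fibreLimitAE` — one-link ratio limits (measurable, positive, fibre-dominated) + ceiling ⇒ the body of the rev-3 crux
# `SpecificationLimitAE` (stmt-QuantumFields-22688: measurable, a.e.-positive, fibre-normalised in-measure specification limit), and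
# `fibreLimit` = the registered stub `stub_fibreLimit` of the rev-1/2 line «link_ratio_limit» on `PointwiseSpecificationLimit`
# (stmt-QuantumFields-28303, now aside) with its abbreviations unfolded: `RatioBody → CeilingBody → CruxBody`

Cell `ym-idea-1` width seat `ym-line-sfw-p2-w3` gen 27 (free hands).  The line's skeleton
(`lineK13-specification_compactness/bc/PointwiseSpecificationLimit_v2.lean`, registered on stmt-QuantumFields-28303) reduces C1 to
`stub_linkRatioLimit` (XL: configuration-wise limits `R_e(V,w)` of the one-link ratios `ρ̂_K(V[e↦w])/ρ̂_K(V)` with fibre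
domination), `stub_conditionalDensityCeiling` (L: `δ·ρ̂_K ≤ E_{π₀}[ρ̂_K | links ≠ e]`) and the measure-theoretic glue
`stub_fibreLimit` (M).  THIS FILE proves that glue for `π₀ = fieldMeasure` (product Haar), `ρ̂_K = unitDensity F γ K`
(`unitDensity_props`: measurable, non-negative, integrable) and the links-`≠ e` σ-algebra, from the generic kernel
`SpecificationCompactnessFibreRatioKernel` (§3 there per link; one floor for all links by `(1 + Σ_e δ_e⁻¹)⁻¹`;
`tendstoInMeasure_of_tendsto_ae`).  The LINE-13 skeleton's `theorem stub_fibreLimit : __Registered.stub_fibreLimit` is then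
`:= SpecificationCompactnessFibreRatioLimit.fibreLimit` (checked against the skeleton's verbatim definitions, rc 0); for the rev-3 crux
`SpecificationLimitAE` (LINE 14, skeleton «link_ratio_ae» with stubs `stub_linkRatioLimitAE` + `stub_limitNondegenerate`),
`fibreLimitAE` is the ALTERNATIVE composition «configuration-wise ratio limits + ceiling ⇒ crux body» — the in-measure limit it
produces, `q_e = (∫ R_e(·,w) dw)⁻¹`, is automatically measurable, a.e. positive and fibre-normalised (no separate non-degeneracy stub).

HONEST FRAMING: rung R3 RECORD line (leaf `YM3TorusSU2`, not Clay).  The ratio limits and the ceiling are the line's Bałaban-facing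
stubs and stay hypotheses; no crux, route, rung or mass gap is proved.  Sources: O. Kallenberg, *Foundations of Modern Probability*
(2002), Thm 6.4; [Balaban1985UV3] (1)–(3) p. 256 for `ρ̂_K`.
-/

noncomputable section

namespace Summit.QuantumFields.YangMills.Theorems.SpecificationCompactnessFibreRatioLimit

open MeasureTheory Filter Topology Function Set
open Summit.QuantumFields.YangMills.Theorems.GibbsLimitUniqueness (condExp_pi_ae_eq_integral_update)
open Summit.QuantumFields.YangMills.Theorems.SpecificationCompactnessFibreRatioKernel

/-! ## §4 The line's glue stub in the route's own vocabulary: `RatioBody → CeilingBody → CruxBody` -/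

section YM

open scoped Classical
open Literature.MathematicalPhysics.QuantumFieldTheory.Balaban1983to89
open Literature.MathematicalPhysics.QuantumFieldTheory.Balaban1983to89.T3ContinuumYM3Torus
open Literature.MathematicalPhysics.QuantumFieldTheory.Balaban1983to89.T3UnitLawDensityEML
open Literature.MathematicalPhysics.QuantumFieldTheory.Balaban1983to89.T3OrbitAverage

/-- **THE FIBRE LIMIT (the line «link_ratio_limit»'s `stub_fibreLimit`, with its abbreviations unfolded).**  For Bałaban's
renormalised unit densities `ρ̂_K = unitDensity F γ K` on `X₀ = SU(2)^{links of T₁}` with product Haar `π₀ = fieldMeasure`: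
configuration-wise one-link RATIO LIMITS `ρ̂_K(V[e↦w])/ρ̂_K(V) → R_e(V,w)` (continuous, positive, fibre-dominated, `π₀`-a.e. `V`)
and a cut-off-uniform CEILING `δ·ρ̂_K ≤ E_{π₀}[ρ̂_K | links ≠ e]` give the crux body of `PointwiseSpecificationLimit` at `(F, γ)`:
a continuous specification `q_e = (∫ R_e(·,w) dw)⁻¹` with a positive floor, fibre normalisation `E_{π₀}[q_e | links ≠ e] = 1`
a.e., and convergence IN `π₀`-MEASURE of the canonical single-link conditional densities to `q_e`.  This is the measure theory
only; the ratio limits and the ceiling are the line's Bałaban-facing stubs and stay hypotheses. [cite: Kallenberg2002, Thm 6.4] -/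
theorem fibreLimit :
    ∀ (F : T3Family) (γ : ℝ), 0 < γ →
      (∀ e : PBond (F.P 0) 0,
        ∃ R : GaugeField (F.P 0) 0 (Matrix.specialUnitaryGroup (Fin 2) ℂ) × Matrix.specialUnitaryGroup (Fin 2) ℂ → ℝ,
          Continuous R ∧ (∀ z, 0 < R z) ∧
          ∀ᵐ V ∂(fieldMeasure (F.P 0) 0 (Matrix.specialUnitaryGroup (Fin 2) ℂ)),
            (∃ (B : ℝ) (K₀ : ℕ), ∀ K : ℕ, K₀ ≤ K → ∀ w : Matrix.specialUnitaryGroup (Fin 2) ℂ,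
              unitDensity F γ K (update V e w) ≤ B * unitDensity F γ K V) ∧
            ∀ w : Matrix.specialUnitaryGroup (Fin 2) ℂ,
              Tendsto (fun K : ℕ => unitDensity F γ K (update V e w) / unitDensity F γ K V) atTop (nhds (R (V, w)))) →
      (∃ (δ : ℝ) (K₀ : ℕ), 0 < δ ∧ ∀ K : ℕ, K₀ ≤ K → ∀ e : PBond (F.P 0) 0,
        ∀ᵐ V ∂(fieldMeasure (F.P 0) 0 (Matrix.specialUnitaryGroup (Fin 2) ℂ)),
          δ * unitDensity F γ K V ≤
            condExp (MeasurableSpace.comap (fun (W : GaugeField (F.P 0) 0 (Matrix.specialUnitaryGroup (Fin 2) ℂ))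
              (b : {b : PBond (F.P 0) 0 // b ≠ e}) => W b.1) MeasurableSpace.pi)
              (fieldMeasure (F.P 0) 0 (Matrix.specialUnitaryGroup (Fin 2) ℂ)) (unitDensity F γ K) V) →
      ∃ (δ : ℝ) (q : PBond (F.P 0) 0 → GaugeField (F.P 0) 0 (Matrix.specialUnitaryGroup (Fin 2) ℂ) → ℝ),
        0 < δ ∧ (∀ e, Continuous (q e)) ∧ (∀ e V, δ ≤ q e V) ∧
        (∀ e, ∀ᵐ V ∂(fieldMeasure (F.P 0) 0 (Matrix.specialUnitaryGroup (Fin 2) ℂ)),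
          condExp (MeasurableSpace.comap (fun (W : GaugeField (F.P 0) 0 (Matrix.specialUnitaryGroup (Fin 2) ℂ))
            (b : {b : PBond (F.P 0) 0 // b ≠ e}) => W b.1) MeasurableSpace.pi)
            (fieldMeasure (F.P 0) 0 (Matrix.specialUnitaryGroup (Fin 2) ℂ)) (q e) V = 1) ∧
        ∀ e, TendstoInMeasure (fieldMeasure (F.P 0) 0 (Matrix.specialUnitaryGroup (Fin 2) ℂ))
          (fun (K : ℕ) (V : GaugeField (F.P 0) 0 (Matrix.specialUnitaryGroup (Fin 2) ℂ)) =>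
            unitDensity F γ K V /
              condExp (MeasurableSpace.comap (fun (W : GaugeField (F.P 0) 0 (Matrix.specialUnitaryGroup (Fin 2) ℂ))
                (b : {b : PBond (F.P 0) 0 // b ≠ e}) => W b.1) MeasurableSpace.pi)
                (fieldMeasure (F.P 0) 0 (Matrix.specialUnitaryGroup (Fin 2) ℂ)) (unitDensity F γ K) V)
          atTop (q e) := by
  intro F γ hγ hR hC
  haveI hηP : IsProbabilityMeasure (HaarData.haar : Measure (Matrix.specialUnitaryGroup (Fin 2) ℂ)) := HaarData.isProb
  choose R hRc hR0 hrat using hR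
  obtain ⟨δ, K₁, hδ, hceil⟩ := hC
  have hu := fun K => unitDensity_props F K hγ.le
  -- the links-`≠ e` σ-algebra is a sub-σ-algebra
  have hmle : ∀ e : PBond (F.P 0) 0,
      MeasurableSpace.comap (fun (W : GaugeField (F.P 0) 0 (Matrix.specialUnitaryGroup (Fin 2) ℂ))
        (b : {b : PBond (F.P 0) 0 // b ≠ e}) => W b.1) MeasurableSpace.pi ≤
        (MeasurableSpace.pi : MeasurableSpace (PBond (F.P 0) 0 → Matrix.specialUnitaryGroup (Fin 2) ℂ)) := fun e =>
    Measurable.comap_le (measurable_pi_lambda _ fun b =>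
      measurable_pi_apply (X := fun _ : PBond (F.P 0) 0 => Matrix.specialUnitaryGroup (Fin 2) ℂ) b.1)
  -- §3 per link
  have main : ∀ e : PBond (F.P 0) 0,
      (∀ᵐ V ∂(fieldMeasure (F.P 0) 0 (Matrix.specialUnitaryGroup (Fin 2) ℂ)),
        Tendsto (fun K : ℕ => unitDensity F γ K V /
          condExp (MeasurableSpace.comap (fun (W : GaugeField (F.P 0) 0 (Matrix.specialUnitaryGroup (Fin 2) ℂ))
            (b : {b : PBond (F.P 0) 0 // b ≠ e}) => W b.1) MeasurableSpace.pi)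
            (fieldMeasure (F.P 0) 0 (Matrix.specialUnitaryGroup (Fin 2) ℂ)) (unitDensity F γ K) V) atTop
          (𝓝 (∫ w, R e (V, w) ∂(HaarData.haar : Measure (Matrix.specialUnitaryGroup (Fin 2) ℂ)))⁻¹)) ∧
      ∀ᵐ V ∂(fieldMeasure (F.P 0) 0 (Matrix.specialUnitaryGroup (Fin 2) ℂ)),
        condExp (MeasurableSpace.comap (fun (W : GaugeField (F.P 0) 0 (Matrix.specialUnitaryGroup (Fin 2) ℂ))
          (b : {b : PBond (F.P 0) 0 // b ≠ e}) => W b.1) MeasurableSpace.pi)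
          (fieldMeasure (F.P 0) 0 (Matrix.specialUnitaryGroup (Fin 2) ℂ))
          (fun V => (∫ w, R e (V, w) ∂(HaarData.haar : Measure (Matrix.specialUnitaryGroup (Fin 2) ℂ)))⁻¹) V = 1 := by
    intro e
    have h := condDensity_limit_ae (HaarData.haar : Measure (Matrix.specialUnitaryGroup (Fin 2) ℂ)) e
      (fun K => unitDensity F γ K) (fun K => (hu K).1) (fun K => (hu K).2.1) (fun K => (hu K).2.2)
      (R e) (hRc e).measurable (hR0 e) (hrat e) hδ (fun K hK => hceil K hK e)
    exact ⟨h.1.mono fun W hW => hW.1, h.2⟩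
  have cont : ∀ e : PBond (F.P 0) 0, ∃ δ' : ℝ,
      Continuous (fun V : GaugeField (F.P 0) 0 (Matrix.specialUnitaryGroup (Fin 2) ℂ) =>
        (∫ w, R e (V, w) ∂(HaarData.haar : Measure (Matrix.specialUnitaryGroup (Fin 2) ℂ)))⁻¹) ∧
      0 < δ' ∧ ∀ V : GaugeField (F.P 0) 0 (Matrix.specialUnitaryGroup (Fin 2) ℂ),
        δ' ≤ (∫ w, R e (V, w) ∂(HaarData.haar : Measure (Matrix.specialUnitaryGroup (Fin 2) ℂ)))⁻¹ := by
    intro e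
    obtain ⟨hc, δ', hδ', hfl⟩ := continuous_invIntegral (ι := PBond (F.P 0) 0)
      (HaarData.haar : Measure (Matrix.specialUnitaryGroup (Fin 2) ℂ)) (R e) (hRc e) (hR0 e)
    exact ⟨δ', hc, hδ', hfl⟩
  choose δe hqc hδe hfloor using cont
  have hsum : 0 ≤ ∑ e, (δe e)⁻¹ := Finset.sum_nonneg fun e _ => inv_nonneg.mpr (hδe e).le
  refine ⟨(1 + ∑ e, (δe e)⁻¹)⁻¹,
    fun e V => (∫ w, R e (V, w) ∂(HaarData.haar : Measure (Matrix.specialUnitaryGroup (Fin 2) ℂ)))⁻¹,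
    inv_pos.mpr (by linarith), hqc, ?_, fun e => (main e).2, fun e => ?_⟩
  · intro e V
    have h1 : (δe e)⁻¹ ≤ 1 + ∑ e', (δe e')⁻¹ := by
      have h : (δe e)⁻¹ ≤ ∑ e', (δe e')⁻¹ :=
        Finset.single_le_sum (f := fun e' => (δe e')⁻¹) (fun e' _ => inv_nonneg.mpr (hδe e').le) (Finset.mem_univ e)
      linarith
    calc (1 + ∑ e', (δe e')⁻¹)⁻¹ ≤ ((δe e)⁻¹)⁻¹ := inv_anti₀ (inv_pos.mpr (hδe e)) h1
      _ = δe e := inv_inv _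
      _ ≤ _ := hfloor e V
  · refine tendstoInMeasure_of_tendsto_ae (fun K => ?_) (main e).1
    exact ((hu K).1.div ((stronglyMeasurable_condExp.mono (hmle e)).measurable)).aestronglyMeasurable


/-- **THE FIBRE LIMIT FOR THE REV-3 CRUX `SpecificationLimitAE` (stmt-QuantumFields-22688).**  Configuration-wise one-link RATIO LIMITS
`ρ̂_K(V[e↦w])/ρ̂_K(V) → R_e(V,w)` with `R_e` merely MEASURABLE and positive, fibre-dominated for `π₀`-a.e. `V`, together with a
cut-off-uniform CEILING `δ·ρ̂_K ≤ E_{π₀}[ρ̂_K | links ≠ e]`, give the body of `SpecificationLimitAE` at `(F, γ)`: the in-measure limit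
`q_e := (∫ R_e(·,w) dw)⁻¹` of the canonical single-link conditional densities is measurable, non-negative, `π₀`-a.e. positive and
fibre-normalised.  (So along this door the line's non-degeneracy stub is automatic; the ratio limits and the ceiling remain the
Bałaban-facing hypotheses.) [cite: Kallenberg2002, Thm 6.4] -/
theorem fibreLimitAE :
    ∀ (F : T3Family) (γ : ℝ), 0 < γ →
      (∀ e : PBond (F.P 0) 0,
        ∃ R : GaugeField (F.P 0) 0 (Matrix.specialUnitaryGroup (Fin 2) ℂ) × Matrix.specialUnitaryGroup (Fin 2) ℂ → ℝ,
          Measurable R ∧ (∀ z, 0 < R z) ∧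
          ∀ᵐ V ∂(fieldMeasure (F.P 0) 0 (Matrix.specialUnitaryGroup (Fin 2) ℂ)),
            (∃ (B : ℝ) (K₀ : ℕ), ∀ K : ℕ, K₀ ≤ K → ∀ w : Matrix.specialUnitaryGroup (Fin 2) ℂ,
              unitDensity F γ K (update V e w) ≤ B * unitDensity F γ K V) ∧
            ∀ w : Matrix.specialUnitaryGroup (Fin 2) ℂ,
              Tendsto (fun K : ℕ => unitDensity F γ K (update V e w) / unitDensity F γ K V) atTop (nhds (R (V, w)))) →
      (∃ (δ : ℝ) (K₀ : ℕ), 0 < δ ∧ ∀ K : ℕ, K₀ ≤ K → ∀ e : PBond (F.P 0) 0,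
        ∀ᵐ V ∂(fieldMeasure (F.P 0) 0 (Matrix.specialUnitaryGroup (Fin 2) ℂ)),
          δ * unitDensity F γ K V ≤
            condExp (MeasurableSpace.comap (fun (W : GaugeField (F.P 0) 0 (Matrix.specialUnitaryGroup (Fin 2) ℂ))
              (b : {b : PBond (F.P 0) 0 // b ≠ e}) => W b.1) MeasurableSpace.pi)
              (fieldMeasure (F.P 0) 0 (Matrix.specialUnitaryGroup (Fin 2) ℂ)) (unitDensity F γ K) V) →
      ∃ q : PBond (F.P 0) 0 → GaugeField (F.P 0) 0 (Matrix.specialUnitaryGroup (Fin 2) ℂ) → ℝ,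
        (∀ e, Measurable (q e)) ∧ (∀ e V, 0 ≤ q e V) ∧
        (∀ e, ∀ᵐ V ∂(fieldMeasure (F.P 0) 0 (Matrix.specialUnitaryGroup (Fin 2) ℂ)), 0 < q e V) ∧
        (∀ e, ∀ᵐ V ∂(fieldMeasure (F.P 0) 0 (Matrix.specialUnitaryGroup (Fin 2) ℂ)),
          condExp (MeasurableSpace.comap (fun (W : GaugeField (F.P 0) 0 (Matrix.specialUnitaryGroup (Fin 2) ℂ))
            (b : {b : PBond (F.P 0) 0 // b ≠ e}) => W b.1) MeasurableSpace.pi)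
            (fieldMeasure (F.P 0) 0 (Matrix.specialUnitaryGroup (Fin 2) ℂ)) (q e) V = 1) ∧
        ∀ e, TendstoInMeasure (fieldMeasure (F.P 0) 0 (Matrix.specialUnitaryGroup (Fin 2) ℂ))
          (fun (K : ℕ) (V : GaugeField (F.P 0) 0 (Matrix.specialUnitaryGroup (Fin 2) ℂ)) =>
            unitDensity F γ K V /
              condExp (MeasurableSpace.comap (fun (W : GaugeField (F.P 0) 0 (Matrix.specialUnitaryGroup (Fin 2) ℂ))
                (b : {b : PBond (F.P 0) 0 // b ≠ e}) => W b.1) MeasurableSpace.pi)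
                (fieldMeasure (F.P 0) 0 (Matrix.specialUnitaryGroup (Fin 2) ℂ)) (unitDensity F γ K) V)
          atTop (q e) := by
  intro F γ hγ hR hC
  haveI hηP : IsProbabilityMeasure (HaarData.haar : Measure (Matrix.specialUnitaryGroup (Fin 2) ℂ)) := HaarData.isProb
  choose R hRm hR0 hrat using hR
  obtain ⟨δ, K₁, hδ, hceil⟩ := hC
  have hu := fun K => unitDensity_props F K hγ.le
  have hmle : ∀ e : PBond (F.P 0) 0,
      MeasurableSpace.comap (fun (W : GaugeField (F.P 0) 0 (Matrix.specialUnitaryGroup (Fin 2) ℂ))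
        (b : {b : PBond (F.P 0) 0 // b ≠ e}) => W b.1) MeasurableSpace.pi ≤
        (MeasurableSpace.pi : MeasurableSpace (PBond (F.P 0) 0 → Matrix.specialUnitaryGroup (Fin 2) ℂ)) := fun e =>
    Measurable.comap_le (measurable_pi_lambda _ fun b =>
      measurable_pi_apply (X := fun _ : PBond (F.P 0) 0 => Matrix.specialUnitaryGroup (Fin 2) ℂ) b.1)
  -- §3 of the kernel per link
  have main : ∀ e : PBond (F.P 0) 0,
      (∀ᵐ V ∂(fieldMeasure (F.P 0) 0 (Matrix.specialUnitaryGroup (Fin 2) ℂ)),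
        Tendsto (fun K : ℕ => unitDensity F γ K V /
          condExp (MeasurableSpace.comap (fun (W : GaugeField (F.P 0) 0 (Matrix.specialUnitaryGroup (Fin 2) ℂ))
            (b : {b : PBond (F.P 0) 0 // b ≠ e}) => W b.1) MeasurableSpace.pi)
            (fieldMeasure (F.P 0) 0 (Matrix.specialUnitaryGroup (Fin 2) ℂ)) (unitDensity F γ K) V) atTop
          (𝓝 (∫ w, R e (V, w) ∂(HaarData.haar : Measure (Matrix.specialUnitaryGroup (Fin 2) ℂ)))⁻¹)) ∧
      ∀ᵐ V ∂(fieldMeasure (F.P 0) 0 (Matrix.specialUnitaryGroup (Fin 2) ℂ)),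
        condExp (MeasurableSpace.comap (fun (W : GaugeField (F.P 0) 0 (Matrix.specialUnitaryGroup (Fin 2) ℂ))
          (b : {b : PBond (F.P 0) 0 // b ≠ e}) => W b.1) MeasurableSpace.pi)
          (fieldMeasure (F.P 0) 0 (Matrix.specialUnitaryGroup (Fin 2) ℂ))
          (fun V => (∫ w, R e (V, w) ∂(HaarData.haar : Measure (Matrix.specialUnitaryGroup (Fin 2) ℂ)))⁻¹) V = 1 := by
    intro e
    have h := condDensity_limit_ae (HaarData.haar : Measure (Matrix.specialUnitaryGroup (Fin 2) ℂ)) e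
      (fun K => unitDensity F γ K) (fun K => (hu K).1) (fun K => (hu K).2.1) (fun K => (hu K).2.2)
      (R e) (hRm e) (hR0 e) (hrat e) hδ (fun K hK => hceil K hK e)
    exact ⟨h.1.mono fun W hW => hW.1, h.2⟩
  -- a.e. positivity of the limit: the ratio limits are bounded along a.e. fibre, hence integrable with a positive integral (§2)
  have hpos : ∀ e : PBond (F.P 0) 0, ∀ᵐ V ∂(fieldMeasure (F.P 0) 0 (Matrix.specialUnitaryGroup (Fin 2) ℂ)),
      0 < (∫ w, R e (V, w) ∂(HaarData.haar : Measure (Matrix.specialUnitaryGroup (Fin 2) ℂ)))⁻¹ := by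
    intro e
    have hfibu : ∀ᵐ V ∂(fieldMeasure (F.P 0) 0 (Matrix.specialUnitaryGroup (Fin 2) ℂ)), ∀ K,
        condExp (MeasurableSpace.comap (fun (W : GaugeField (F.P 0) 0 (Matrix.specialUnitaryGroup (Fin 2) ℂ))
          (b : {b : PBond (F.P 0) 0 // b ≠ e}) => W b.1) MeasurableSpace.pi)
          (fieldMeasure (F.P 0) 0 (Matrix.specialUnitaryGroup (Fin 2) ℂ)) (unitDensity F γ K) V =
          ∫ w, unitDensity F γ K (update V e w) ∂(HaarData.haar : Measure (Matrix.specialUnitaryGroup (Fin 2) ℂ)) := by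
      rw [ae_all_iff]
      intro K
      exact condExp_pi_ae_eq_integral_update _ e (hu K).1.stronglyMeasurable (hu K).2.2
    filter_upwards [hrat e, hfibu] with V hV hf
    obtain ⟨⟨B, K₀, hB⟩, hlim⟩ := hV
    obtain ⟨-, hIpos, -⟩ := tendsto_condDensity_of_ratio (HaarData.haar : Measure (Matrix.specialUnitaryGroup (Fin 2) ℂ)) e
      (fun K => unitDensity F γ K) (fun K => (hu K).1) (fun K => (hu K).2.1) V (fun w => R e (V, w))
      ((hRm e).comp measurable_prodMk_left) (fun w => hR0 e _) hB hlim _ hf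
    exact inv_pos.mpr hIpos
  refine ⟨fun e V => (∫ w, R e (V, w) ∂(HaarData.haar : Measure (Matrix.specialUnitaryGroup (Fin 2) ℂ)))⁻¹,
    fun e => ?_, fun e V => inv_nonneg.mpr (integral_nonneg fun w => (hR0 e _).le), hpos, fun e => (main e).2, fun e => ?_⟩
  · exact ((hRm e).stronglyMeasurable.integral_prod_right').measurable.inv
  · refine tendstoInMeasure_of_tendsto_ae (fun K => ?_) (main e).1
    exact ((hu K).1.div ((stronglyMeasurable_condExp.mono (hmle e)).measurable)).aestronglyMeasurable

end YM

end Summit.QuantumFields.YangMills.Theorems.SpecificationCompactnessFibreRatioLimit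

end
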